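import Summits.CriticalPhenomena.PercolationContinuityZ3.Theorems.PercNearOneGluingNoHeavyQuantLightSiblingRelays
import HarnessLib

/-!
# QUANT lane R8, T-DEC: FORESTS OF LIGHT SIBLINGS ARE SDEC, k-GENERAL — II. the theorem: every forest whose siblings satisfy
# `qᵢ·mean ρᵢ ≤ 2·(least relay count)` — in particular every sibling with `qᵢ·mean ρᵢ ≤ 2` — is SDEC at every per-sibling-affordable
# floor; any width, any sub-forest shapes, no oracle, no certificate (arm-1 gen 56, architect)

builds on p205010 (kernel theorem, internal audit signed; external expert review pending)

Support file (`--supports stmt-CriticalPhenomena-4575`), QUANT lane seat prim-quant-arm-1 (gen 56, architect); memo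
`run/shared/lean/prim/quant/prim-quant-arm-1-g56/ARCH-G56.md` §3.  Theorems only (file-local notation, no definitions); standard axioms, no
sorries.  Mechanism and tools: `…QuantLightSiblingCore` (part I).

THE THEOREM (`sdec_flaw_of_light`).  Let `L` be any list of law-OK siblings `gate ρᵢ qᵢ` (`0 < qᵢ < 1`, `ρᵢ` a probability law on `{0..Mᵢ}`),
`0 < x` a floor with PER-SIBLING AFFORDABILITY `x·Mᵢ ≤ qᵢ·mean ρᵢ` (automatic for tree-OK siblings), and suppose every sibling is LIGHT:
`qᵢ·mean ρᵢ ≤ 2·h` for every charged relay count `h ≥ 1` of `ρᵢ` (for a sibling tree with a root relay: `qᵢ·mean ρᵢ ≤ 2·rᵢ`, `rᵢ` the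
least count).  Then **`SDEC x (ftop L) (flaw L)`** — every width, every root gate, no oracle, no certificate.  SPECIAL CASES:
**`sdec_flaw_of_siblingMean_le_two`** (every sibling with `qᵢ·mean ρᵢ ≤ 2` is light): this contains EVERY FOREST OF 2-CHAINS (`…QuantTopTwoForest`),
census-1 g28's mean-light forests (`sdec_flaw_of_meanLight`, `qᵢ·mean ρᵢ ≤ 1`), arm-1 g54's light-mean forests (`sdec_flaw_of_fmean_le_two`:
the WHOLE forest mean `≤ 2` — here each sibling separately, so `fmean L` up to `2k`), every forest of 3-chains `R[q](R[p](R[r]))` with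
`q(1+p+pr) ≤ 2`, of cherries `R[q](R[p] R[p′])` with `q(1+p+p′) ≤ 2`, of stars `R[q](j leaves at c)` with `q(1+jc) ≤ 2`, mixed at will; and the
tree-OK forms `sdec_flaw_of_light_treeOK`, `sdec_flaw_of_siblingMean_le_two_treeOK` (the node `LawDec.SiblingStep`, list binder
`siblingStep_iff_list`, HOLDS for every forest of light siblings, unconditionally).

THE PROOF.  Induction on the list with a LIGHT HUB-CORE universally quantified (`sdec_hubCore_flaw`).  The new sibling's gated law `t` (mean
`m = q·mean ρ ≥ x·M`) is replaced by its canonical same-mean two-point decomposition (Lemma P, `exists_twoPoint_decomposition_TA`;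
`sdec_of_mixture_finset`): a component `{0, hi; γ}` is a blob of gate `γ = m/hi ≥ x`, sliced in last (`sdec_lconv_lconv_blob'`); a component
`{lo, hi; γ}` with `lo ≥ 1` has `(hi − lo)γ = m − lo ≤ lo` by lightness and joins the core (`sdec_lconv_lconv_toCore`); the core alone has no
positive low atom at any gate (`sdec_hubCore_light`, the moment criterion `decAt_all_of_noLow`).

WHY LIGHTNESS IS THE EXACT REACH OF THE METHOD (memo §2).  For a HEAVY sibling (`m > 2·lo` for a charged `lo ≥ 1`) the canonical decomposition
contains a far-giant component `{lo, hi; γ}` with `(hi−lo)γ > lo`; when `γ < x` it violates the FAR row on its own at a dominant layer (the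
mechanism of census-1 g24's `not_lightResidDECLaw`), although the sibling itself may well be SDEC — e.g. the 3-chain `R[.9](R[.889](R[.9375]))`
at the tree-OK floor `x = .74`: component `{1: .275, 3: .725}`, row `x ≤ P(N ≥ 2) = .725` fails.  So the sibling step for forests with heavy
siblings needs floor-adapted decompositions or the torque transport; it stays OPEN.

HONEST STATUS.  `SiblingStep` / `GateStepN` / `LightResidDECOracle` / `FarTreeRow` OPEN (heavy siblings); RATE class (log\*) / honest sentence
of `run/shared/lean/prim/quant/README.md` unchanged.  [this work].  Nothing here is cited as a published result.  The gluing rows served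
[cite: KozmaNitzan2024, Conjecture 3 (p. 15)]; product measure [cite: Grimmett1999, §1.3 p. 10].
-/

noncomputable section

open scoped BigOperators

namespace Summit.CriticalPhenomena.PercolationContinuityZ3.Theorems
namespace Quant
namespace LawDec

open Finset

/-- the point mass `δ_K` -/
local notation3 "δ[" K "]" => (fun k : ℕ => if k = (K : ℕ) then (1 : ℝ) else 0)

/-- the two-point law `{lo, lo+K; g}` = `lo` sure relays and a blob of size `K` at gate `g` -/
local notation3 "TPL[" lo ", " K ", " g "]" => lconv lo K δ[lo] (gate δ[K] g)

/-- the two-point law as a pseudo-sibling with the sure root gate `1` -/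
local notation3 "HS[" lo ", " K ", " g "]" => (⟨1, 0, 0, lo + K, TPL[lo, K, g]⟩ : Sib)

/-- the hub-core of elements `(lo, K, γ)` -/
local notation3 "HC[" cs "]" => List.map (fun c : ℕ × ℕ × ℝ => HS[c.1, c.2.1, c.2.2]) cs

/-! ### Bookkeeping -/

/-- `x·ftop L ≤ fmean L` at a per-sibling-affordable floor. [this work] -/
theorem floor_ftop_le_fmean' (x : ℝ) : ∀ L : List Sib, (∀ s ∈ L, x * (s.M : ℝ) ≤ s.q * s.mean) → x * (ftop L : ℝ) ≤ fmean L
  | [], _ => by simp [ftop, fmean]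
  | s :: L, hx => by
    have ih := floor_ftop_le_fmean' x L (fun t ht => hx t (List.mem_cons_of_mem s ht))
    have hxs := hx s List.mem_cons_self
    simp only [ftop, fmean, Nat.cast_add]
    linarith

/-- the mean of a sibling law is at most its top. [this work] -/
theorem Sib.mean_le_top (s : Sib) (hs : s.LawOK) : s.mean ≤ s.M := by
  obtain ⟨_, _, ρ0, _, ρ1⟩ := hs
  have hle : ∀ h ∈ Finset.range (s.M + 1), (h : ℝ) * s.ρ h ≤ (s.M : ℝ) * s.ρ h := fun h hh =>
    mul_le_mul_of_nonneg_right (by exact_mod_cast Nat.lt_succ_iff.1 (Finset.mem_range.1 hh)) (ρ0 h)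
  calc s.mean ≤ ∑ h ∈ Finset.range (s.M + 1), (s.M : ℝ) * s.ρ h := Finset.sum_le_sum hle
    _ = s.M := by rw [← Finset.mul_sum, ρ1, mul_one]

/-- a list with positive total top has a sibling with positive top. [this work] -/
theorem exists_top_pos_of_ftop_pos : ∀ L : List Sib, 0 < ftop L → ∃ s ∈ L, 0 < s.M
  | [], h => by simp [ftop] at h
  | s :: L, h => by
    simp only [ftop] at h
    by_cases hs : 0 < s.M
    · exact ⟨s, List.mem_cons_self, hs⟩
    · obtain ⟨t, ht, htM⟩ := exists_top_pos_of_ftop_pos L (by omega)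
      exact ⟨t, List.mem_cons_of_mem s ht, htM⟩

/-- **law facts of `flaw HC[cs] ∗ flaw L`** for a hub-core with gates in `[0,1]`, light and affordable, beside law-OK siblings at a
per-sibling-affordable floor: a probability law on `{0..ftop HC[cs] + ftop L}` of mean `Σ(lo_j + K_jγ_j) + fmean L ≥ x·top`. [this work] -/
theorem hubCore_flaw_facts (x : ℝ) (cs : List (ℕ × ℕ × ℝ)) (L : List Sib) (hL : ∀ s ∈ L, s.LawOK)
    (hxL : ∀ s ∈ L, x * (s.M : ℝ) ≤ s.q * s.mean) (hg : ∀ c ∈ cs, 0 ≤ c.2.2 ∧ c.2.2 ≤ 1)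
    (hlight : ∀ c ∈ cs, (c.2.1 : ℝ) * c.2.2 ≤ c.1) (haff : ∀ c ∈ cs, x * ((c.1 : ℝ) + c.2.1) ≤ c.1 + c.2.1 * c.2.2) :
    (∀ h, 0 ≤ lconv (ftop HC[cs]) (ftop L) (flaw HC[cs]) (flaw L) h) ∧
    (∀ h, ftop HC[cs] + ftop L < h → lconv (ftop HC[cs]) (ftop L) (flaw HC[cs]) (flaw L) h = 0) ∧
    (∑ h ∈ Finset.range (ftop HC[cs] + ftop L + 1), lconv (ftop HC[cs]) (ftop L) (flaw HC[cs]) (flaw L) h = 1) ∧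
    (∑ h ∈ Finset.range (ftop HC[cs] + ftop L + 1), (h : ℝ) * lconv (ftop HC[cs]) (ftop L) (flaw HC[cs]) (flaw L) h
        = (cs.map fun c => (c.1 : ℝ) + c.2.1 * c.2.2).sum + fmean L) ∧
    x * ((ftop HC[cs] + ftop L : ℕ) : ℝ) ≤ (cs.map fun c => (c.1 : ℝ) + c.2.1 * c.2.2).sum + fmean L := by
  obtain ⟨c0, cM, c1, cmn, _⟩ := hubCore_facts cs hg
  obtain ⟨f0, fM, f1, fmn⟩ := flaw_facts L hL
  obtain ⟨hb1, _⟩ := hubCore_bounds x cs hlight haff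
  have hfl := floor_ftop_le_fmean' x L hxL
  refine ⟨lconv_nonneg _ _ _ _ c0 f0, fun h hh => lconv_eq_zero _ _ _ _ h hh, sum_lconv _ _ _ _ c1 f1,
    by rw [sum_mul_lconv _ _ _ _ c1 f1, cmn, fmn], ?_⟩
  rw [Nat.cast_add, ftop_hubCore]; linarith

/-! ### The induction step -/

/-- **the induction step**: adding one TAME affordable sibling `s` to `flaw HC[cs] ∗ flaw L`, given the conclusion for `(cs, L)` and for every
light affordable enlarged core `(c :: cs, L)` — Lemma P on the sibling's gated law; empty / blob / light-core / floored-relays branches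
(`…QuantLightSiblingCore`, `…QuantLightSiblingRelays`); `sdec_of_mixture_finset`. [this work] -/
theorem sdec_hubCore_flaw_step {x : ℝ} (hx0 : 0 < x) (hx1 : x < 1) (cs : List (ℕ × ℕ × ℝ)) (L : List Sib) (s : Sib)
    (hL : ∀ t ∈ L, t.LawOK) (hxL : ∀ t ∈ L, x * (t.M : ℝ) ≤ t.q * t.mean) (hs : s.LawOK) (hxs : x * (s.M : ℝ) ≤ s.q * s.mean)
    (hls : ∀ h : ℕ, 1 ≤ h → s.ρ h ≠ 0 → s.q * s.mean ≤ 2 * h ∨ x * ((s.M : ℝ) - h) ≤ s.q * s.mean - h)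
    (hg : ∀ c ∈ cs, 0 ≤ c.2.2 ∧ c.2.2 ≤ 1) (hlight : ∀ c ∈ cs, (c.2.1 : ℝ) * c.2.2 ≤ c.1)
    (haff : ∀ c ∈ cs, x * ((c.1 : ℝ) + c.2.1) ≤ c.1 + c.2.1 * c.2.2)
    (ih : SDEC x (ftop HC[cs] + ftop L) (lconv (ftop HC[cs]) (ftop L) (flaw HC[cs]) (flaw L)))
    (ihC : ∀ c : ℕ × ℕ × ℝ, 0 ≤ c.2.2 → c.2.2 ≤ 1 → (c.2.1 : ℝ) * c.2.2 ≤ c.1 → x * ((c.1 : ℝ) + c.2.1) ≤ c.1 + c.2.1 * c.2.2 →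
      SDEC x (ftop HC[c :: cs] + ftop L) (lconv (ftop HC[c :: cs]) (ftop L) (flaw HC[c :: cs]) (flaw L))) :
    SDEC x (ftop HC[cs] + ftop (s :: L)) (lconv (ftop HC[cs]) (ftop (s :: L)) (flaw HC[cs]) (flaw (s :: L))) := by
  classical
  obtain ⟨hq0, hq1, ρ0, ρM, ρ1⟩ := hs
  obtain ⟨c0, _, c1, cmn, _⟩ := hubCore_facts cs hg
  obtain ⟨f0, fM, f1, fmn⟩ := flaw_facts L hL
  obtain ⟨a0, aM, a1, amn, ata⟩ := hubCore_flaw_facts x cs L hL hxL hg hlight haff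
  rw [← amn] at ata
  -- the new sibling's gated law `t` on `{0..M}`, mean `m = q·mean ρ ≥ x·M`
  simp only [ftop, flaw]
  obtain ⟨t0, tM, t1⟩ := gate_laws s.M s.ρ s.q hq0.le hq1.le ρ0 ρM ρ1
  have tmn : ∑ h ∈ Finset.range (s.M + 1), (h : ℝ) * gate s.ρ s.q h = s.q * s.mean := by rw [sum_mul_gate]; rfl
  have htop : ∀ h, 0 < gate s.ρ s.q h → x * (h : ℝ) ≤ ∑ k ∈ Finset.range (s.M + 1), (k : ℝ) * gate s.ρ s.q k := by
    intro h hh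
    have hhM : h ≤ s.M := by
      by_contra hlt; exact (lt_irrefl (0 : ℝ)) (by rw [tM h (not_le.1 hlt)] at hh; exact hh)
    rw [tmn]
    have : x * (h : ℝ) ≤ x * s.M := mul_le_mul_of_nonneg_left (by exact_mod_cast hhM) hx0.le
    linarith
  -- Lemma P: the canonical same-mean two-point decomposition of `t`
  obtain ⟨lam, g, lo, hi, l0, l1, lg, llohi, lhi, lμ, lgen⟩ :=
    exists_twoPoint_decomposition_TA s.M s.M le_rfl (gate s.ρ s.q) t0 tM t1 x htop
  have et : gate s.ρ s.q = fun h => ∑ r, lam r * (TPL[lo r, hi r - lo r, g r]) h := by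
    funext h
    rw [lμ h]
    refine Finset.sum_congr rfl fun r _ => ?_
    rw [tpLaw_apply, Nat.add_sub_of_le (llohi r)]
  have e1 : lconv (ftop L) s.M (flaw L) (fun h => ∑ r, lam r * (TPL[lo r, hi r - lo r, g r]) h)
      = fun h => ∑ r, lam r * lconv (ftop L) s.M (flaw L) (TPL[lo r, hi r - lo r, g r]) h :=
    funext fun h => lconv_fsum_right _ _ _ _ _ _ h
  have e2 : lconv (ftop HC[cs]) (ftop L + s.M) (flaw HC[cs])
        (fun h => ∑ r, lam r * lconv (ftop L) s.M (flaw L) (TPL[lo r, hi r - lo r, g r]) h)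
      = fun h => ∑ r, lam r * lconv (ftop HC[cs]) (ftop L + s.M) (flaw HC[cs])
          (lconv (ftop L) s.M (flaw L) (TPL[lo r, hi r - lo r, g r])) h :=
    funext fun h => lconv_fsum_right _ _ _ _ _ _ h
  rw [et, e1, e2]
  refine sdec_of_mixture_finset Finset.univ lam _ x
    (∑ h ∈ Finset.range (ftop HC[cs] + ftop L + 1), (h : ℝ) * lconv (ftop HC[cs]) (ftop L) (flaw HC[cs]) (flaw L) h + s.q * s.mean)
    _ (fun r _ => l0 r) l1 (fun r _ hr => ?_) (fun r _ hr => ?_)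
  · -- every genuine component gives a law of the common mean
    obtain ⟨_, _, cmean, _, _⟩ := lgen r hr
    have hlh := llohi r
    obtain ⟨_, pM, p1, pmn, _⟩ := hs_facts (lo r) (hi r - lo r) (g r) (lg r).1 (lg r).2
    rw [Nat.add_sub_of_le hlh] at pM p1 pmn
    have p1' : ∑ h ∈ Finset.range (s.M + 1), (TPL[lo r, hi r - lo r, g r]) h = 1 := by
      rw [sum_range_top_mono (hi r) s.M (lhi r) _ pM, p1]
    have pmn' : ∑ h ∈ Finset.range (s.M + 1), (h : ℝ) * (TPL[lo r, hi r - lo r, g r]) h = s.q * s.mean := by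
      rw [sum_range_widen (hi r) s.M (lhi r) _ pM, pmn, ← tmn, ← cmean]
      push_cast [Nat.cast_sub hlh]; ring
    rw [sum_mul_lconv _ _ _ _ c1 (sum_lconv _ _ _ _ f1 p1'), sum_mul_lconv _ _ _ _ f1 p1', pmn',
      sum_mul_lconv _ _ _ _ c1 f1, cmn, fmn]
    ring
  · -- every genuine component gives an SDEC law: blob / empty / core
    obtain ⟨clo, _, cmean, _, _⟩ := lgen r hr
    rw [tmn] at cmean
    have hlh := llohi r
    obtain ⟨p0, pM, p1, pmn, _⟩ := hs_facts (lo r) (hi r - lo r) (g r) (lg r).1 (lg r).2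
    by_cases hlo : lo r = 0
    · have hK : hi r - lo r = hi r := by rw [hlo, Nat.sub_zero]
      by_cases hhi : hi r = 0
      · -- the empty component `δ₀` (then `m = 0`)
        have hm0 : s.q * s.mean = 0 := by
          rw [← cmean, hlo, hhi]; simp
        have e0 : (TPL[lo r, hi r - lo r, g r]) = δ[0] := by
          funext h; rw [tpLaw_apply, hK, hhi, hlo]; ring
        rw [e0]
        refine sdec_lconv_lconv_delta hx0 hx1 fM a0 aM a1 ?_ ih
        push_cast at ata ⊢; nlinarith
      · -- a blob of size `hi ≥ 1` at gate `g = m/hi ≥ x`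
        have hhi1 : 1 ≤ hi r := Nat.one_le_iff_ne_zero.2 hhi
        have hmean' : (hi r : ℝ) * g r = s.q * s.mean := by rw [← cmean, hlo]; push_cast; ring
        have hxg : x ≤ g r := by
          have hh0 : (0 : ℝ) < hi r := by exact_mod_cast hhi1
          nlinarith
        have e0 : (TPL[lo r, hi r - lo r, g r]) = gate δ[hi r] (g r) := by
          funext h; rw [hK, hlo]; exact lconv_delta_left _ _ _ (fun k hk => by rw [gate_apply, if_neg (by omega), if_neg (by omega)]; ring) h
        rw [e0]
        exact sdec_lconv_lconv_blob' hx0 hx1 hxg (lg r).2 hhi1 (lhi r)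
          (by rw [show g r * (hi r : ℝ) = hi r * g r from mul_comm _ _, hmean']; exact hxs) a0 aM a1 ata ih
    · -- `lo ≥ 1`: `lo` sure relays and a blob of size `K = hi − lo` at gate `γ`
      have hlo1 : 1 ≤ lo r := Nat.one_le_iff_ne_zero.2 hlo
      have hρlo : s.ρ (lo r) ≠ 0 := by
        intro hz; rw [gate_apply, hz, if_neg hlo] at clo; simp at clo
      have hKg : ((hi r - lo r : ℕ) : ℝ) * g r = s.q * s.mean - lo r := by
        rw [← cmean]; push_cast [Nat.cast_sub hlh]; ring
      by_cases hcl : ((hi r - lo r : ℕ) : ℝ) * g r ≤ lo r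
      · -- a LIGHT component: it joins the hub-core
        have haf : x * ((lo r : ℝ) + (hi r - lo r : ℕ)) ≤ lo r + (hi r - lo r : ℕ) * g r := by
          rw [hKg]; push_cast [Nat.cast_sub hlh]; linarith
        have ih' := ihC (lo r, hi r - lo r, g r) (lg r).1 (lg r).2 hcl haf
        rw [flaw_hubCore_cons] at ih'
        simp only [List.map_cons, ftop] at ih'
        have hHM : lo r + (hi r - lo r) ≤ s.M := by rw [Nat.add_sub_of_le hlh]; exact lhi r
        refine sdec_lconv_lconv_toCore (H := lo r + (hi r - lo r)) hx0 hx1 hHM c0 c1 f0 f1 p0 pM p1 ?_ ih'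
        rw [pmn, cmn, fmn]
        rw [sum_mul_lconv _ _ _ _ c1 f1, cmn, fmn] at ata
        push_cast [Nat.cast_sub hlh] at ata hKg ⊢
        nlinarith
      · -- a HEAVY component: the sibling is floored at `lo`, so `γ ≥ x` — relay slices and a blob slice
        have hfl : x * ((s.M : ℝ) - lo r) ≤ s.q * s.mean - lo r := by
          rcases hls (lo r) hlo1 hρlo with hm2 | hfl
          · exfalso; apply hcl; rw [hKg]; linarith
          · exact hfl
        have hlt' : lo r < hi r := by
          by_contra hle
          have e : hi r = lo r := le_antisymm (not_lt.1 hle) hlh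
          apply hcl; rw [e, Nat.sub_self]; simp
        have hKpos : (0 : ℝ) < ((hi r - lo r : ℕ) : ℝ) := by exact_mod_cast Nat.sub_pos_of_lt hlt'
        have hKle : ((hi r - lo r : ℕ) : ℝ) ≤ (s.M : ℝ) - lo r := by
          have : (hi r : ℝ) ≤ s.M := by exact_mod_cast lhi r
          push_cast [Nat.cast_sub hlh]; linarith
        have hxγ : x ≤ g r := by
          by_contra hlt
          have hγx : g r < x := not_le.1 hlt
          have h1 : ((hi r - lo r : ℕ) : ℝ) * g r < ((hi r - lo r : ℕ) : ℝ) * x := mul_lt_mul_of_pos_left hγx hKpos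
          have h2 : ((hi r - lo r : ℕ) : ℝ) * x ≤ ((s.M : ℝ) - lo r) * x := mul_le_mul_of_nonneg_right hKle hx0.le
          linarith
        have hKM : lo r + (hi r - lo r) ≤ s.M := by rw [Nat.add_sub_of_le hlh]; exact lhi r
        refine sdec_lconv_lconv_relaysBlob hx0 hx1 hxγ (lg r).2 hKM ?_ a0 aM a1 ata ih
        rw [hKg]; linarith

/-- **LIGHT CORE ∗ TAME FOREST.**  For `0 < x < 1`, law-OK TAME siblings at a per-sibling-affordable floor and a light affordable hub-core `cs`
(gates in `[0,1]`): `flaw HC[cs] ∗ flaw L` is SDEC at `x` — induction on `L`, the core universally quantified. [this work] -/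
theorem sdec_hubCore_flaw {x : ℝ} (hx0 : 0 < x) (hx1 : x < 1) :
    ∀ (L : List Sib) (cs : List (ℕ × ℕ × ℝ)), (∀ s ∈ L, s.LawOK) → (∀ s ∈ L, x * (s.M : ℝ) ≤ s.q * s.mean) →
      (∀ s ∈ L, ∀ h : ℕ, 1 ≤ h → s.ρ h ≠ 0 → s.q * s.mean ≤ 2 * h ∨ x * ((s.M : ℝ) - h) ≤ s.q * s.mean - h) →
      (∀ c ∈ cs, 0 ≤ c.2.2 ∧ c.2.2 ≤ 1) → (∀ c ∈ cs, (c.2.1 : ℝ) * c.2.2 ≤ c.1) →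
      (∀ c ∈ cs, x * ((c.1 : ℝ) + c.2.1) ≤ c.1 + c.2.1 * c.2.2) →
      SDEC x (ftop HC[cs] + ftop L) (lconv (ftop HC[cs]) (ftop L) (flaw HC[cs]) (flaw L))
  | [], cs, _, _, _, hg, hlight, haff => by
    obtain ⟨_, cM, _, _, _⟩ := hubCore_facts cs hg
    have e : lconv (ftop HC[cs]) (ftop []) (flaw HC[cs]) (flaw []) = flaw HC[cs] := by
      funext h; simp only [ftop, flaw]; exact lconv_delta_right _ _ _ cM h
    rw [e]
    simp only [ftop, Nat.add_zero]
    exact sdec_hubCore_light hx0 hx1 cs hg hlight haff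
  | s :: L, cs, hL, hxL, hlL, hg, hlight, haff => by
    have hL' : ∀ t ∈ L, t.LawOK := fun t ht => hL t (List.mem_cons_of_mem s ht)
    have hxL' : ∀ t ∈ L, x * (t.M : ℝ) ≤ t.q * t.mean := fun t ht => hxL t (List.mem_cons_of_mem s ht)
    have hlL' : ∀ t ∈ L, ∀ h : ℕ, 1 ≤ h → t.ρ h ≠ 0 → t.q * t.mean ≤ 2 * h ∨ x * ((t.M : ℝ) - h) ≤ t.q * t.mean - h :=
      fun t ht => hlL t (List.mem_cons_of_mem s ht)
    refine sdec_hubCore_flaw_step hx0 hx1 cs L s hL' hxL' (hL s List.mem_cons_self) (hxL s List.mem_cons_self)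
      (hlL s List.mem_cons_self) hg hlight haff (sdec_hubCore_flaw hx0 hx1 L cs hL' hxL' hlL' hg hlight haff)
      fun c hc0 hc1 hcl hca => ?_
    refine sdec_hubCore_flaw hx0 hx1 L (c :: cs) hL' hxL' hlL' (fun c' hc' => ?_) (fun c' hc' => ?_) (fun c' hc' => ?_)
    · rcases List.mem_cons.1 hc' with rfl | hc'
      · exact ⟨hc0, hc1⟩
      · exact hg c' hc'
    · rcases List.mem_cons.1 hc' with rfl | hc'
      · exact hcl
      · exact hlight c' hc'
    · rcases List.mem_cons.1 hc' with rfl | hc'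
      · exact hca
      · exact haff c' hc'

/-! ### The theorems -/

/-- **FORESTS OF TAME SIBLINGS ARE SDEC, k-GENERAL.**  Law-OK siblings, a floor `0 < x` with `x·Mᵢ ≤ qᵢ·mean ρᵢ` for every sibling, every sibling
TAME at `x`: for every charged count `h ≥ 1` of `ρᵢ`, EITHER `qᵢ·mean ρᵢ ≤ 2·h` (light at `h`) OR `x·(Mᵢ − h) ≤ qᵢ·mean ρᵢ − h` (floored at `h`:
no component of the canonical decomposition from `h` has its gate below the floor).  Then `SDEC x (ftop L) (flaw L)` — any width, any
sub-forest laws, no oracle, no certificate. [this work] -/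
theorem sdec_flaw_of_tame {x : ℝ} (hx0 : 0 < x) (L : List Sib) (hL : ∀ s ∈ L, s.LawOK)
    (hx : ∀ s ∈ L, x * (s.M : ℝ) ≤ s.q * s.mean)
    (htame : ∀ s ∈ L, ∀ h : ℕ, 1 ≤ h → s.ρ h ≠ 0 → s.q * s.mean ≤ 2 * h ∨ x * ((s.M : ℝ) - h) ≤ s.q * s.mean - h) :
    SDEC x (ftop L) (flaw L) := by
  by_cases hft : ftop L = 0
  · intro a _ _ j hj; omega
  -- `x < 1`: some sibling has `M ≥ 1`, and `x·M ≤ q·mean ρ ≤ q·M < M`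
  obtain ⟨s, hs, hsM⟩ := exists_top_pos_of_ftop_pos L (Nat.pos_of_ne_zero hft)
  have hx1 : x < 1 := by
    obtain ⟨hq0, hq1, _, _, _⟩ := hL s hs
    have hm := Sib.mean_le_top s (hL s hs)
    have hxs := hx s hs
    have hM0 : (0 : ℝ) < s.M := by exact_mod_cast hsM
    have : x * (s.M : ℝ) < 1 * s.M := by nlinarith
    nlinarith
  obtain ⟨_, fM, _, _⟩ := flaw_facts L hL
  have h := sdec_hubCore_flaw hx0 hx1 L [] hL hx htame (fun c hc => by simp at hc) (fun c hc => by simp at hc)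
    (fun c hc => by simp at hc)
  have e : lconv (ftop HC[([] : List (ℕ × ℕ × ℝ))]) (ftop L) (flaw HC[([] : List (ℕ × ℕ × ℝ))]) (flaw L) = flaw L := by
    funext h; simp only [List.map_nil, flaw]; exact lconv_delta_left _ _ _ fM h
  rw [e] at h
  simpa [ftop] using h

/-- **FORESTS OF LIGHT SIBLINGS ARE SDEC** (`qᵢ·mean ρᵢ ≤ 2·h` for every charged count `h ≥ 1` — for a sibling tree with a root relay:
`qᵢ·mean ρᵢ ≤ 2·rᵢ`, `rᵢ` the least count) at every per-sibling-affordable floor; any width, no oracle. [this work] -/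
theorem sdec_flaw_of_light {x : ℝ} (hx0 : 0 < x) (L : List Sib) (hL : ∀ s ∈ L, s.LawOK)
    (hx : ∀ s ∈ L, x * (s.M : ℝ) ≤ s.q * s.mean) (hlight : ∀ s ∈ L, ∀ h : ℕ, 1 ≤ h → s.ρ h ≠ 0 → s.q * s.mean ≤ 2 * h) :
    SDEC x (ftop L) (flaw L) :=
  sdec_flaw_of_tame hx0 L hL hx fun s hs h h1 hh => Or.inl (hlight s hs h h1 hh)

/-- **FORESTS OF FLOORED SIBLINGS ARE SDEC** (`x·(Mᵢ − h) ≤ qᵢ·mean ρᵢ − h` for every charged count `h ≥ 1`: the canonical decomposition has no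
gate below the floor — census-1 g28's reducibility regime, here k-general and oracle-free beside the light regime). [this work] -/
theorem sdec_flaw_of_floored {x : ℝ} (hx0 : 0 < x) (L : List Sib) (hL : ∀ s ∈ L, s.LawOK)
    (hx : ∀ s ∈ L, x * (s.M : ℝ) ≤ s.q * s.mean)
    (hfl : ∀ s ∈ L, ∀ h : ℕ, 1 ≤ h → s.ρ h ≠ 0 → x * ((s.M : ℝ) - h) ≤ s.q * s.mean - h) : SDEC x (ftop L) (flaw L) :=
  sdec_flaw_of_tame hx0 L hL hx fun s hs h h1 hh => Or.inr (hfl s hs h h1 hh)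

/-- **EVERY FOREST OF SIBLINGS WITH `qᵢ·mean ρᵢ ≤ 2` IS SDEC** at every per-sibling-affordable floor — any width, any sub-forest laws, no oracle.
Contains every forest of 2-chains, of mean-light siblings, and of any siblings `R[q](F)` with `q·(1 + mean F) ≤ 2`. [this work] -/
theorem sdec_flaw_of_siblingMean_le_two {x : ℝ} (hx0 : 0 < x) (L : List Sib) (hL : ∀ s ∈ L, s.LawOK)
    (hx : ∀ s ∈ L, x * (s.M : ℝ) ≤ s.q * s.mean) (hm : ∀ s ∈ L, s.q * s.mean ≤ 2) : SDEC x (ftop L) (flaw L) :=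
  sdec_flaw_of_light hx0 L hL hx fun s hs h h1 _ => (hm s hs).trans (by exact_mod_cast (show 2 ≤ 2 * h by omega))

/-- per-sibling affordability from tree-OK data: `x ≤ q·x₁` and `x₁·M ≤ mean ρ`. [this work] -/
theorem Sib.TreeOK.afford {x : ℝ} {s : Sib} (h : s.TreeOK x) : x * (s.M : ℝ) ≤ s.q * s.mean := by
  obtain ⟨hq0, _, hxq, hT, _⟩ := h
  obtain ⟨_, _, _, _, _, hta⟩ := hT.lawFacts
  have hta' : s.x₁ * (s.M : ℝ) ≤ s.mean := hta
  have hM : (0 : ℝ) ≤ s.M := Nat.cast_nonneg _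
  nlinarith [mul_le_mul_of_nonneg_right hxq hM]

/-- **THE NODE `SiblingStep` HOLDS FOR FORESTS OF TAME SIBLINGS, UNCONDITIONALLY** (list binder of `siblingStep_iff_list`; no oracle, any width):
tree-OK siblings at `0 < x`, each tame at `x` ⟹ `SDEC x (ftop L) (flaw L)`. [this work] -/
theorem sdec_flaw_of_tame_treeOK {x : ℝ} (hx0 : 0 < x) (L : List Sib) (hL : ∀ s ∈ L, s.TreeOK x)
    (htame : ∀ s ∈ L, ∀ h : ℕ, 1 ≤ h → s.ρ h ≠ 0 → s.q * s.mean ≤ 2 * h ∨ x * ((s.M : ℝ) - h) ≤ s.q * s.mean - h) :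
    SDEC x (ftop L) (flaw L) :=
  sdec_flaw_of_tame hx0 L (fun s hs => (hL s hs).lawOK) (fun s hs => (hL s hs).afford) htame

/-- **THE NODE `SiblingStep` HOLDS FOR FORESTS OF LIGHT SIBLINGS, UNCONDITIONALLY.** [this work] -/
theorem sdec_flaw_of_light_treeOK {x : ℝ} (hx0 : 0 < x) (L : List Sib) (hL : ∀ s ∈ L, s.TreeOK x)
    (hlight : ∀ s ∈ L, ∀ h : ℕ, 1 ≤ h → s.ρ h ≠ 0 → s.q * s.mean ≤ 2 * h) : SDEC x (ftop L) (flaw L) :=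
  sdec_flaw_of_light hx0 L (fun s hs => (hL s hs).lawOK) (fun s hs => (hL s hs).afford) hlight

/-- **THE NODE `SiblingStep` HOLDS FOR FORESTS OF SIBLINGS WITH `qᵢ·mean ρᵢ ≤ 2`, UNCONDITIONALLY.** [this work] -/
theorem sdec_flaw_of_siblingMean_le_two_treeOK {x : ℝ} (hx0 : 0 < x) (L : List Sib) (hL : ∀ s ∈ L, s.TreeOK x)
    (hm : ∀ s ∈ L, s.q * s.mean ≤ 2) : SDEC x (ftop L) (flaw L) :=
  sdec_flaw_of_siblingMean_le_two hx0 L (fun s hs => (hL s hs).lawOK) (fun s hs => (hL s hs).afford) hm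

end LawDec
end Quant
end Summit.CriticalPhenomena.PercolationContinuityZ3.Theorems
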